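import Summits.CriticalPhenomena.Ising3DConformalLimit.Theses.GaussianScaleMixture

/-!
# `stub_circleClosed` of line `two-crystals-generate-so3` (crux `RotationUpgradeFromTwoPoint`,
stmt-CriticalPhenomena-8367) — kernel-checked verification by the deep-refute seat

Statement copied VERBATIM from `Cruxes/RotationUpgradeFromTwoPoint/Lines/two-crystals-generate-so3.lean`
(gen 2). Proof: `H := {φ | S is T φ-invariant}` is an additive subgroup of `ℝ` (group law; `T 0 = 1`
by injectivity), CLOSED (continuity of `S n` on the open `T`-stable set `NonCoincident`, zero off it,
continuity of `φ ↦ T φ x`), contains `θ₀` and `2π`; by `AddSubgroup.dense_or_cyclic` it is dense (hence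
`ℝ`) or cyclic `ℤa`, and the latter gives `m θ₀ = k·2π` with `m ≠ 0`, excluded.
Candidate proof for the worker holding the stub (refuters do not land positive statements).
-/

noncomputable section

open Literature.Probability.LatticeModels Set

namespace Summit.CriticalPhenomena.Ising3DConformalLimit.Cruxes.RotationUpgradeFromTwoPoint.DrefuteTwoCrystals

local notation "E3" => EuclideanSpace ℝ (Fin 3)

/-- **`stub_circleClosed`** (verbatim). [folklore] -/
theorem circleClosed_holds :
  ∀ (S : CorrFamily 3) (T : ℝ → (E3 ≃ₗᵢ[ℝ] E3)) (θ₀ : ℝ),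
    (∀ n, ContinuousOn (S n) (NonCoincident 3 n)) →
    (∀ n z, z ∉ NonCoincident 3 n → S n z = 0) →
    (∀ φ ψ x, T (φ + ψ) x = T φ (T ψ x)) →
    (∀ x, Continuous fun φ => T φ x) →
    (∀ x, T (2 * Real.pi) x = x) →
    (∀ m k : ℤ, m ≠ 0 → (m : ℝ) * θ₀ ≠ (k : ℝ) * (2 * Real.pi)) →
    (∀ (n : ℕ) (x : Fin n → E3), S n (fun i => T θ₀ (x i)) = S n x) →
    ∀ (φ : ℝ) (n : ℕ) (x : Fin n → E3), S n (fun i => T φ (x i)) = S n x := by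
  intro S T θ₀ hcont hzero hgrp hTcont h2pi hirr hθ₀
  -- `T 0 = 1`
  have hT0 : ∀ x, T 0 x = x := by
    intro x
    have h := hgrp 0 0 x
    rw [add_zero] at h
    exact ((T 0).injective h).symm
  -- the invariance subgroup
  let H : AddSubgroup ℝ :=
    { carrier := {φ | ∀ (n : ℕ) (x : Fin n → E3), S n (fun i => T φ (x i)) = S n x}
      zero_mem' := by
        intro n x
        simp only [hT0]
      add_mem' := by
        intro φ ψ hφ hψ n x
        have h1 := hφ n (fun i => T ψ (x i))
        have h2 := hψ n x
        simp only [hgrp]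
        rw [h1, h2]
      neg_mem' := by
        intro φ hφ n x
        have h1 := hφ n (fun i => T (-φ) (x i))
        have hcfg : (fun i => T φ (T (-φ) (x i))) = x := by
          funext i
          rw [← hgrp, add_neg_cancel, hT0]
        rw [hcfg] at h1
        exact h1.symm }
  have hmem : ∀ {φ : ℝ}, φ ∈ H ↔ ∀ (n : ℕ) (x : Fin n → E3), S n (fun i => T φ (x i)) = S n x :=
    fun {φ} => Iff.rfl
  -- `H` is closed
  have hclosed : IsClosed (H : Set ℝ) := by
    have hset : (H : Set ℝ) = ⋂ (n : ℕ), ⋂ (x : Fin n → E3),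
        {φ | S n (fun i => T φ (x i)) = S n x} := by
      ext φ
      simp only [SetLike.mem_coe, mem_iInter, mem_setOf_eq]
      exact hmem
    rw [hset]
    refine isClosed_iInter fun n => isClosed_iInter fun x => ?_
    by_cases hx : x ∈ NonCoincident 3 n
    · have hmaps : ∀ φ, (fun i => T φ (x i)) ∈ NonCoincident 3 n := by
        intro φ
        rw [mem_nonCoincident] at hx ⊢
        exact (T φ).injective.comp hx
      have hg : Continuous fun φ : ℝ => S n (fun i => T φ (x i)) :=
        (hcont n).comp_continuous (continuous_pi fun i => hTcont (x i)) hmaps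
      exact isClosed_eq hg continuous_const
    · have huniv : {φ : ℝ | S n (fun i => T φ (x i)) = S n x} = univ := by
        refine eq_univ_of_forall fun φ => ?_
        have hTx : (fun i => T φ (x i)) ∉ NonCoincident 3 n := by
          intro h
          apply hx
          rw [mem_nonCoincident] at h ⊢
          intro i j hij
          exact h (by simp only [hij])
        show S n (fun i => T φ (x i)) = S n x
        rw [hzero n _ hTx, hzero n x hx]
      rw [huniv]
      exact isClosed_univ
  -- `θ₀ ∈ H`, `2π ∈ H`
  have hθ₀H : θ₀ ∈ H := hmem.2 hθ₀
  have h2piH : 2 * Real.pi ∈ H := hmem.2 fun n x => by simp only [h2pi]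
  -- `H = ℝ`
  have htop : ∀ φ : ℝ, φ ∈ H := by
    rcases AddSubgroup.dense_or_cyclic H with hd | ⟨a, ha⟩
    · intro φ
      have : φ ∈ closure (H : Set ℝ) := hd φ
      rwa [hclosed.closure_eq] at this
    · exfalso
      rw [ha, AddSubgroup.mem_closure_singleton] at hθ₀H h2piH
      obtain ⟨k, hk⟩ := hθ₀H
      obtain ⟨m, hm⟩ := h2piH
      have hm0 : m ≠ 0 := by
        rintro rfl
        rw [zero_zsmul] at hm
        linarith [Real.pi_pos]
      refine hirr m k hm0 ?_
      rw [← hk, ← hm, zsmul_eq_mul, zsmul_eq_mul]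
      ring
  intro φ
  exact hmem.1 (htop φ)

end Summit.CriticalPhenomena.Ising3DConformalLimit.Cruxes.RotationUpgradeFromTwoPoint.DrefuteTwoCrystals

end
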